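import Mathlib
import HarnessLib
import Summits.Ventures.LatticeQCDFlow.Scoring.UStatisticMedianOfBlocks
import Summits.Ventures.LatticeQCDFlow.Scoring.AllPairsAcceptanceVariance

/-!
# The acceptance column WITHOUT a weight ceiling, at EXPONENTIAL confidence: the median of the
# block all-pairs estimates of ONE proposal stream is within `2/√(m − 1)` of `acc(p, q)` with
# probability `≥ 1 − e^{−R/8}`

HONEST FRAMING: exact (Metropolis-corrected) sampling algorithms for lattice gauge theory;
figures of merit are autocorrelation/cost numbers at stated couplings and volumes; no
continuum-physics claim.

Venture `LatticeQCDFlow` (cell pub-lqcd), topic `Scoring`; FANOUT row 4 (`s0-u1-b`, rung S0-B: two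
independent codes A, B for the 2D U(1) flow sampler; acceptance test "A vs B within 3 pp").
Every EXPONENTIAL acceptance certificate of rows 3/4 so far (`Scoring/PairedDrawAcceptance`,
`Scoring/AllPairsAcceptance`, `Scoring/AllPairsAcceptanceRatio`) needs a WEIGHT CEILING `p ≤ W·q`
— the Hoeffding radius is `W·√(log(2/δ)/(2⌊n/2⌋))`, the Bernstein upper tail sees `W` through
`Wt/3` — while a normalizing flow certifies no ceiling at all (its log-weight is unbounded on a
continuous field space); and row 3's ceiling-free `Scoring/AllPairsAcceptanceVariance` (imported:
the exact variance of the all-pairs estimate and its SHARP envelope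
`Var Û ≤ (2(1 − a²) + 4(n − 2)a(1 − a))/(n(n − 1))`, `a = acc(p, q)`, from `c₂ ≤ 1`, `c₁ ≤ a`) stops
at CHEBYSHEV level, noting that exponential tails for `Û` itself are impossible without a ceiling.
The median of blocks gets exponential CONFIDENCE anyway: cut ONE stream of `n` independent model
draws into `R` disjoint blocks of `m ≥ 2` draws (`R·m ≤ n`), print on each block the all-pairs
estimate `Û_r = Σ_{i ≠ j} min(w_i, w_j)/(m(m − 1))` (`w = p/q`), and read the median; row 4's
`Scoring/UStatisticMedianOfBlocks` (imported: Joly–Lugosi's diagonal blocks with Hoeffding's exact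
block variance `V_m`) bounds the probability that half the blocks miss `acc` by `t` by `e^{−R/8}` as
soon as `4V_m ≤ t²`, and row 3's envelope makes `V_m ≤ (2(1 − a²) + 4(m − 2)(a − a²))/(m(m − 1))
≤ 1/(m − 1)` an A-PRIORI, CEILING-FREE input.

## Content (`ν = μ.withDensity q`; `w = p/q`; `acc = ∫∫ min(p(a)q(b), p(b)q(a)) dμ dμ`)

* §1 **`blockVariance_pairMin_le`** — the envelope in the `(c₂, c₁, μ_F)`-form consumed by the
  median certificate: `V_m ≤ (2(1 − acc²) + 4(m − 2)(acc − acc²))/(m(m − 1))`;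
  `acceptanceEnvelope_le_inv` — `… ≤ 1/(m − 1)` for every value of `acc`.
* §2 **`acceptance_medianOfBlocks_confidence`** — `n` independent model draws, `m ≥ 2`, `R·m ≤ n`,
  `t > 0` with `4·(2(1 − acc²) + 4(m − 2)(acc − acc²))/(m(m − 1)) ≤ t²`:
  `P( #{r < R : t ≤ |Û_r − acc|} ≥ R/2 ) ≤ exp(−R/8)`; **`acceptance_medianOfBlocks_confidence_simple`**
  — the same under `4/(m − 1) ≤ t²` ALONE; `acceptance_AB_medianOfBlocks_confidence` — two codes
  `q, q′`, each from ITS OWN stream (possibly on different probability spaces), nothing assumed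
  between them: outside an event of probability `≤ e^{−R/8} + e^{−R′/8}` both medians are within
  `t`, `t′` of `acc(p,q)`, `acc(p,q′)`.
* §3 `abs_median_sub_lt_of_card_lt` (deterministic: a median of values fewer than half of which are
  `t`-far from `c` is `t`-close to `c`) and **`acceptance_sampleMedian_confidence`** (oracle
  envelope) / **`…_simple`** (`4/(m − 1) ≤ t²`) — for ANY selection `med(ω)` of a sample median of
  the `R` printed block estimates: `P(t ≤ |med − acc(p, q)|) ≤ exp(−R/8)`; the oracle form is the
  coverage statement of the data-driven Wilson-type set `{a : (med − a)² < 4E_m(a)}`.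

Reading for row 4 (value-free; no number of ours, no sealed value): from `n` proposals, `R ≈ 8 log(1/η)`
blocks give the acceptance to `± 2/√(n/R − 1) ≈ ± 2√(8 log(1/η)/n)` at confidence `1 − η` with NO
ceiling, NO variance estimate and NO parity hypothesis — against `± W√(log(2/η)/n)` for the
Hoeffding certificate, i.e. sharper as soon as `W ≳ 6`, and available when no `W` exists; the
oracle form improves to `± 2√((2(1 − acc²) + 4(m − 2)acc(1 − acc))/(m(m − 1)))` for any a-priori
bracket on `acc`.  NEW WORK of the cell (elementary); no definition is introduced; nothing is cited
as a fact.  NOT CLAIMED: the printed RATIO estimator with unnormalised weights (`Scoring/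
AllPairsAcceptanceRatio`, which keeps its ceiling); the ESS column (the kernel `w²` is not
square-integrable without a fourth moment); a data-driven radius; any number of ours re-scored.
-/

noncomputable section

namespace Summit.Ventures.LatticeQCDFlow.Scoring.AllPairsMedian

open MeasureTheory ProbabilityTheory Finset Real Set
open Summit.Ventures.LatticeQCDFlow.Scoring.BlockMedian

/-! ## §1 The ceiling-free envelope of Hoeffding's block variance for the kernel `min(w, w′)` -/

section Model

variable {X : Type*} [MeasurableSpace X] {μ : Measure X} [SFinite μ] {p q : X → ℝ}

/-- **THE CEILING-FREE VARIANCE ENVELOPE of the block all-pairs estimate**, in the form consumed by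
`BlockMedian.ustat₂_medianOfBlocks_confidence`: for `m ≥ 2`,
`(2(c₂ − acc²) + 4(m − 2)(c₁ − acc²))/(m(m − 1)) ≤ (2(1 − acc²) + 4(m − 2)(acc − acc²))/(m(m − 1))`
— from row 3's `c₂ ≤ 1` (`AllPairsVariance.integral_sq_pairMin_withDensity_le_one`) and `c₁ ≤ acc`
(`AllPairsVariance.integral_condMean_sq_pairMin_le_meanAccept`); no weight ceiling. [ours] -/
theorem blockVariance_pairMin_le
    (hν : IsProbabilityMeasure (μ.withDensity fun z => ENNReal.ofReal (q z)))
    (hp0 : ∀ z, 0 ≤ p z) (hpm : Measurable p) (hpi : Integrable p μ) (hp1 : ∫ z, p z ∂μ = 1)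
    (hq0 : ∀ z, 0 < q z) (hqm : Measurable q) (hqi : Integrable q μ) {m : ℕ} (hm : 2 ≤ m) :
    (2 * ((∫ z, min (p z.1 / q z.1) (p z.2 / q z.2) ^ 2
            ∂((μ.withDensity fun z => ENNReal.ofReal (q z)).prod
              (μ.withDensity fun z => ENNReal.ofReal (q z))))
          - (∫ z, min (p z.1 / q z.1) (p z.2 / q z.2)
            ∂((μ.withDensity fun z => ENNReal.ofReal (q z)).prod
              (μ.withDensity fun z => ENNReal.ofReal (q z)))) ^ 2)
        + 4 * (m - 2) * ((∫ a, (∫ b, min (p a / q a) (p b / q b)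
            ∂(μ.withDensity fun z => ENNReal.ofReal (q z))) ^ 2
            ∂(μ.withDensity fun z => ENNReal.ofReal (q z)))
          - (∫ z, min (p z.1 / q z.1) (p z.2 / q z.2)
            ∂((μ.withDensity fun z => ENNReal.ofReal (q z)).prod
              (μ.withDensity fun z => ENNReal.ofReal (q z)))) ^ 2))
        / (m * (m - 1))
      ≤ (2 * (1 - (∫ a, ∫ b, min (p a * q b) (p b * q a) ∂μ ∂μ) ^ 2)
          + 4 * (m - 2) * ((∫ a, ∫ b, min (p a * q b) (p b * q a) ∂μ ∂μ)
            - (∫ a, ∫ b, min (p a * q b) (p b * q a) ∂μ ∂μ) ^ 2)) / (m * (m - 1)) := by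
  haveI := hν
  rw [AllPairsVariance.integral_pairMin_withDensity_eq_meanAccept hp0 hpm hpi hq0 hqm hqi]
  have h2 : (2 : ℝ) ≤ m := by exact_mod_cast hm
  have hc₂ := AllPairsVariance.integral_sq_pairMin_withDensity_le_one (μ := μ) hp0 hpm hpi hp1
    hq0 hqm
  have hc₁ := AllPairsVariance.integral_condMean_sq_pairMin_le_meanAccept (μ := μ) hp0 hpm hpi
    hp1 hq0 hqm hqi
  have hden : (0 : ℝ) < m * (m - 1) := by
    have : (0 : ℝ) < m - 1 := by linarith
    positivity
  refine div_le_div_of_nonneg_right ?_ hden.le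
  have hm2 : (0 : ℝ) ≤ 4 * (m - 2) := by linarith
  nlinarith [mul_le_mul_of_nonneg_left hc₁ hm2]

omit [MeasurableSpace X] [SFinite μ] in
/-- The envelope is at most `1/(m − 1)`: `2(1 − a²) + 4(m − 2)(a − a²) ≤ m` for every real `a`
(`a − a² ≤ 1/4`). [ours] -/
theorem acceptanceEnvelope_le_inv {a : ℝ} {m : ℕ} (hm : 2 ≤ m) :
    (2 * (1 - a ^ 2) + 4 * (m - 2) * (a - a ^ 2)) / (m * (m - 1) : ℝ) ≤ 1 / (m - 1) := by
  have h2 : (2 : ℝ) ≤ m := by exact_mod_cast hm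
  have hm1 : (0 : ℝ) < m - 1 := by linarith
  have hm0 : (0 : ℝ) < m := by linarith
  rw [div_le_div_iff₀ (by positivity) hm1]
  have hq : a - a ^ 2 ≤ 1 / 4 := by nlinarith [sq_nonneg (a - 1 / 2)]
  have hm2 : (0 : ℝ) ≤ 4 * (m - 2) := by linarith
  nlinarith [mul_le_mul_of_nonneg_left hq hm2, sq_nonneg a]

end Model

/-! ## §2 The ceiling-free certificates -/

section Certificate

variable {Ω : Type*} [MeasurableSpace Ω] {P : Measure Ω} [IsProbabilityMeasure P]
variable {X : Type*} [MeasurableSpace X] {μ : Measure X} [SFinite μ]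
variable {n m R : ℕ}

/-- **THE CEILING-FREE ACCEPTANCE CERTIFICATE (oracle envelope).**  `n` independent model draws
`y₀, …, y_{n−1}` (laws `μ.withDensity q`), target density `p ≥ 0` with `∫ p = 1`, model density
`q > 0`, NO weight ceiling; blocks of `m ≥ 2` draws, `R·m ≤ n`; `t > 0` with
`4·(2(1 − acc²) + 4(m − 2)(acc − acc²))/(m(m − 1)) ≤ t²`.  With
`Û_r = Σ_{i ≠ j < m} min(w(y_{rm+i}), w(y_{rm+j}))/(m(m − 1))` the all-pairs estimate of block `r`:
`P( #{r < R : t ≤ |Û_r − acc(p,q)|} ≥ R/2 ) ≤ exp(−R/8)` — outside that event every sample median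
of `Û_0, …, Û_{R−1}` is within `t` of `acc(p, q)`. [ours] -/
theorem acceptance_medianOfBlocks_confidence {y : Fin n → Ω → X} (hym : ∀ j, Measurable (y j))
    (hind : iIndepFun y P) {p q : X → ℝ} (hp0 : ∀ z, 0 ≤ p z) (hpm : Measurable p)
    (hpi : Integrable p μ) (hp1 : ∫ z, p z ∂μ = 1) (hq0 : ∀ z, 0 < q z) (hqm : Measurable q)
    (hqi : Integrable q μ)
    (hlaw : ∀ j, Measure.map (y j) P = μ.withDensity fun z => ENNReal.ofReal (q z))
    (hm : 2 ≤ m) (hRm : R * m ≤ n) {t : ℝ} (ht : 0 < t)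
    (hvt : 4 * ((2 * (1 - (∫ a, ∫ b, min (p a * q b) (p b * q a) ∂μ ∂μ) ^ 2)
        + 4 * (m - 2) * ((∫ a, ∫ b, min (p a * q b) (p b * q a) ∂μ ∂μ)
          - (∫ a, ∫ b, min (p a * q b) (p b * q a) ∂μ ∂μ) ^ 2)) / (m * (m - 1))) ≤ t ^ 2) :
    P.real {ω | (R : ℝ) / 2 ≤ #{r ∈ (univ : Finset (Fin R)) | t ≤
        |(∑ z ∈ (univ : Finset (Fin m)).offDiag,
            min (p (y ⟨((r : Fin R) : ℕ) * m + z.1, mul_add_lt hRm r z.1⟩ ω)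
                  / q (y ⟨((r : Fin R) : ℕ) * m + z.1, mul_add_lt hRm r z.1⟩ ω))
                (p (y ⟨((r : Fin R) : ℕ) * m + z.2, mul_add_lt hRm r z.2⟩ ω)
                  / q (y ⟨((r : Fin R) : ℕ) * m + z.2, mul_add_lt hRm r z.2⟩ ω)))
            / (m * (m - 1))
          - ∫ a, ∫ b, min (p a * q b) (p b * q a) ∂μ ∂μ|}}
      ≤ exp (-(R / 8)) := by
  rcases Nat.eq_zero_or_pos R with hR | hR
  · subst hR
    refine measureReal_le_one.trans ?_
    simp
  -- a draw exists, so the model law is a probability measure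
  have hn : 0 < n := by
    have : 0 < m := by omega
    have : 0 < R * m := Nat.mul_pos hR this
    omega
  have hν : IsProbabilityMeasure (μ.withDensity fun z => ENNReal.ofReal (q z)) :=
    isProbabilityMeasure_of_map_eq_iid (hym ⟨0, hn⟩) (hlaw ⟨0, hn⟩)
  have h := ustat₂_medianOfBlocks_confidence (ν := μ.withDensity fun z => ENNReal.ofReal (q z))
    (F := fun a b => min (p a / q a) (p b / q b)) hym hind hlaw
    (PairedDraws.measurable_pairMin hpm hqm) (fun a b => min_comm _ _)
    (AllPairsVariance.memLp_pairMin_two hp0 hpm hpi hq0 hqm) hm hRm ht hvt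
    (blockVariance_pairMin_le hν hp0 hpm hpi hp1 hq0 hqm hqi hm)
  rw [AllPairsVariance.integral_pairMin_withDensity_eq_meanAccept hp0 hpm hpi hq0 hqm hqi] at h
  exact h

/-- **THE CEILING-FREE ACCEPTANCE CERTIFICATE (a-priori radius): `4/(m − 1) ≤ t²` suffices.**
Same setting; no quantity of the target or the model enters the radius. [ours] -/
theorem acceptance_medianOfBlocks_confidence_simple {y : Fin n → Ω → X}
    (hym : ∀ j, Measurable (y j)) (hind : iIndepFun y P) {p q : X → ℝ} (hp0 : ∀ z, 0 ≤ p z)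
    (hpm : Measurable p) (hpi : Integrable p μ) (hp1 : ∫ z, p z ∂μ = 1) (hq0 : ∀ z, 0 < q z)
    (hqm : Measurable q) (hqi : Integrable q μ)
    (hlaw : ∀ j, Measure.map (y j) P = μ.withDensity fun z => ENNReal.ofReal (q z))
    (hm : 2 ≤ m) (hRm : R * m ≤ n) {t : ℝ} (ht : 0 < t) (hmt : 4 / (m - 1 : ℝ) ≤ t ^ 2) :
    P.real {ω | (R : ℝ) / 2 ≤ #{r ∈ (univ : Finset (Fin R)) | t ≤
        |(∑ z ∈ (univ : Finset (Fin m)).offDiag,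
            min (p (y ⟨((r : Fin R) : ℕ) * m + z.1, mul_add_lt hRm r z.1⟩ ω)
                  / q (y ⟨((r : Fin R) : ℕ) * m + z.1, mul_add_lt hRm r z.1⟩ ω))
                (p (y ⟨((r : Fin R) : ℕ) * m + z.2, mul_add_lt hRm r z.2⟩ ω)
                  / q (y ⟨((r : Fin R) : ℕ) * m + z.2, mul_add_lt hRm r z.2⟩ ω)))
            / (m * (m - 1))
          - ∫ a, ∫ b, min (p a * q b) (p b * q a) ∂μ ∂μ|}}
      ≤ exp (-(R / 8)) := by
  refine acceptance_medianOfBlocks_confidence hym hind hp0 hpm hpi hp1 hq0 hqm hqi hlaw hm hRm ht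
    ((mul_le_mul_of_nonneg_left (acceptanceEnvelope_le_inv hm) (by norm_num)).trans ?_)
  rw [mul_one_div]
  exact hmt

/-- **A versus B with no ceiling and no parity hypothesis.**  Two codes with model densities
`q, q′` (each `> 0`, measurable, integrable), the same target `p`, each certified from ITS OWN
stream (`n` draws in `R` blocks of `m`, resp. `n′` draws in `R′` blocks of `m′`), radii with
`4/(m − 1) ≤ t²`, `4/(m′ − 1) ≤ t′²`: the union of the two bad events has probability
`≤ exp(−R/8) + exp(−R′/8)` — outside it the two medians are within `t`, `t′` of `acc(p,q)`,
`acc(p,q′)`, so their difference estimates `acc(p,q) − acc(p,q′)` to `±(t + t′)`. [ours] -/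
theorem acceptance_AB_medianOfBlocks_confidence {n' m' R' : ℕ} {Ω' : Type*} [MeasurableSpace Ω']
    {P' : Measure Ω'} [IsProbabilityMeasure P'] {y : Fin n → Ω → X} {y' : Fin n' → Ω' → X}
    (hym : ∀ j, Measurable (y j)) (hind : iIndepFun y P) (hym' : ∀ j, Measurable (y' j))
    (hind' : iIndepFun y' P') {p q q' : X → ℝ} (hp0 : ∀ z, 0 ≤ p z) (hpm : Measurable p)
    (hpi : Integrable p μ) (hp1 : ∫ z, p z ∂μ = 1) (hq0 : ∀ z, 0 < q z) (hqm : Measurable q)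
    (hqi : Integrable q μ) (hq0' : ∀ z, 0 < q' z) (hqm' : Measurable q') (hqi' : Integrable q' μ)
    (hlaw : ∀ j, Measure.map (y j) P = μ.withDensity fun z => ENNReal.ofReal (q z))
    (hlaw' : ∀ j, Measure.map (y' j) P' = μ.withDensity fun z => ENNReal.ofReal (q' z))
    (hm : 2 ≤ m) (hRm : R * m ≤ n) (hm' : 2 ≤ m') (hRm' : R' * m' ≤ n') {t t' : ℝ} (ht : 0 < t)
    (hmt : 4 / (m - 1 : ℝ) ≤ t ^ 2) (ht' : 0 < t') (hmt' : 4 / (m' - 1 : ℝ) ≤ t' ^ 2) :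
    P.real {ω | (R : ℝ) / 2 ≤ #{r ∈ (univ : Finset (Fin R)) | t ≤
        |(∑ z ∈ (univ : Finset (Fin m)).offDiag,
            min (p (y ⟨((r : Fin R) : ℕ) * m + z.1, mul_add_lt hRm r z.1⟩ ω)
                  / q (y ⟨((r : Fin R) : ℕ) * m + z.1, mul_add_lt hRm r z.1⟩ ω))
                (p (y ⟨((r : Fin R) : ℕ) * m + z.2, mul_add_lt hRm r z.2⟩ ω)
                  / q (y ⟨((r : Fin R) : ℕ) * m + z.2, mul_add_lt hRm r z.2⟩ ω)))
            / (m * (m - 1))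
          - ∫ a, ∫ b, min (p a * q b) (p b * q a) ∂μ ∂μ|}}
      + P'.real {ω | (R' : ℝ) / 2 ≤ #{r ∈ (univ : Finset (Fin R')) | t' ≤
        |(∑ z ∈ (univ : Finset (Fin m')).offDiag,
            min (p (y' ⟨((r : Fin R') : ℕ) * m' + z.1, mul_add_lt hRm' r z.1⟩ ω)
                  / q' (y' ⟨((r : Fin R') : ℕ) * m' + z.1, mul_add_lt hRm' r z.1⟩ ω))
                (p (y' ⟨((r : Fin R') : ℕ) * m' + z.2, mul_add_lt hRm' r z.2⟩ ω)
                  / q' (y' ⟨((r : Fin R') : ℕ) * m' + z.2, mul_add_lt hRm' r z.2⟩ ω)))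
            / (m' * (m' - 1))
          - ∫ a, ∫ b, min (p a * q' b) (p b * q' a) ∂μ ∂μ|}}
      ≤ exp (-(R / 8)) + exp (-(R' / 8)) :=
  add_le_add
    (acceptance_medianOfBlocks_confidence_simple hym hind hp0 hpm hpi hp1 hq0 hqm hqi hlaw hm hRm
      ht hmt)
    (acceptance_medianOfBlocks_confidence_simple hym' hind' hp0 hpm hpi hp1 hq0' hqm' hqi' hlaw'
      hm' hRm' ht' hmt')

end Certificate

/-! ## §3 Reading the event: any sample median of the block estimates -/

section Median

/-- **Deterministic reading of the count event.**  If `med` is a median of the values `u_r`,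
`r ∈ s` (at least half of them are `≥ med` and at least half are `≤ med`) and FEWER than half of
the `u_r` are at distance `≥ t` from `c`, then `|med − c| < t`. [ours] -/
theorem abs_median_sub_lt_of_card_lt {ι : Type*} (s : Finset ι) (u : ι → ℝ) {c t med : ℝ}
    (hlo : (#s : ℝ) / 2 ≤ #{r ∈ s | med ≤ u r}) (hhi : (#s : ℝ) / 2 ≤ #{r ∈ s | u r ≤ med})
    (hgood : (#{r ∈ s | t ≤ |u r - c|} : ℝ) < #s / 2) : |med - c| < t := by
  by_contra hcon
  push Not at hcon
  rcases le_total 0 (med - c) with hpos | hneg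
  · -- `med ≥ c + t`: every `u_r ≥ med` is at distance `≥ t` above `c`
    rw [abs_of_nonneg hpos] at hcon
    have hsub : s.filter (fun r => med ≤ u r) ⊆ s.filter (fun r => t ≤ |u r - c|) := by
      intro r hr
      simp only [mem_filter] at hr ⊢
      exact ⟨hr.1, hcon.trans ((by linarith : med - c ≤ u r - c).trans (le_abs_self _))⟩
    have h := Finset.card_le_card hsub
    have h' : (#{r ∈ s | med ≤ u r} : ℝ) ≤ #{r ∈ s | t ≤ |u r - c|} := by exact_mod_cast h
    linarith
  · -- `med ≤ c − t`: every `u_r ≤ med` is at distance `≥ t` below `c`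
    rw [abs_of_nonpos hneg] at hcon
    have hsub : s.filter (fun r => u r ≤ med) ⊆ s.filter (fun r => t ≤ |u r - c|) := by
      intro r hr
      simp only [mem_filter] at hr ⊢
      refine ⟨hr.1, hcon.trans ?_⟩
      rw [← abs_neg]
      exact (by linarith : -(med - c) ≤ -(u r - c)).trans (le_abs_self _)
    have h := Finset.card_le_card hsub
    have h' : (#{r ∈ s | u r ≤ med} : ℝ) ≤ #{r ∈ s | t ≤ |u r - c|} := by exact_mod_cast h
    linarith

variable {Ω : Type*} [MeasurableSpace Ω] {P : Measure Ω} [IsProbabilityMeasure P]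
variable {X : Type*} [MeasurableSpace X] {μ : Measure X} [SFinite μ]
variable {n m R : ℕ}

/-- **THE CEILING-FREE CERTIFICATE FOR THE PRINTED MEDIAN (oracle envelope).**  Same setting
as `acceptance_medianOfBlocks_confidence`; `med : Ω → ℝ` is ANY selection of a sample median of the
`R` block estimates `Û_0(ω), …, Û_{R−1}(ω)` (at least half `≥ med ω`, at least half `≤ med ω`; no
measurability needed).  Then for `t > 0` with `4·(2(1 − acc²) + 4(m − 2)(acc − acc²))/(m(m − 1)) ≤ t²`:
`P(t ≤ |med − acc(p, q)|) ≤ exp(−R/8)`.  Read with `t = t_m(acc) = 2√E_m(acc)`,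
`E_m(a) = (2(1 − a²) + 4(m − 2)(a − a²))/(m(m − 1))`, this says that the DATA-DRIVEN confidence set
`{a ∈ [0, 1] : (med − a)² < 4E_m(a)}` (a Wilson-score-type set, no ceiling, no variance estimate)
misses `acc(p, q)` with probability `≤ e^{−R/8}`. [ours] -/
theorem acceptance_sampleMedian_confidence {y : Fin n → Ω → X} (hym : ∀ j, Measurable (y j))
    (hind : iIndepFun y P) {p q : X → ℝ} (hp0 : ∀ z, 0 ≤ p z) (hpm : Measurable p)
    (hpi : Integrable p μ) (hp1 : ∫ z, p z ∂μ = 1) (hq0 : ∀ z, 0 < q z) (hqm : Measurable q)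
    (hqi : Integrable q μ)
    (hlaw : ∀ j, Measure.map (y j) P = μ.withDensity fun z => ENNReal.ofReal (q z))
    (hm : 2 ≤ m) (hRm : R * m ≤ n) {t : ℝ} (ht : 0 < t)
    (hvt : 4 * ((2 * (1 - (∫ a, ∫ b, min (p a * q b) (p b * q a) ∂μ ∂μ) ^ 2)
        + 4 * (m - 2) * ((∫ a, ∫ b, min (p a * q b) (p b * q a) ∂μ ∂μ)
          - (∫ a, ∫ b, min (p a * q b) (p b * q a) ∂μ ∂μ) ^ 2)) / (m * (m - 1))) ≤ t ^ 2)
    {med : Ω → ℝ}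
    (hlo : ∀ ω, (R : ℝ) / 2 ≤ #{r ∈ (univ : Finset (Fin R)) | med ω ≤
        (∑ z ∈ (univ : Finset (Fin m)).offDiag,
            min (p (y ⟨((r : Fin R) : ℕ) * m + z.1, mul_add_lt hRm r z.1⟩ ω)
                  / q (y ⟨((r : Fin R) : ℕ) * m + z.1, mul_add_lt hRm r z.1⟩ ω))
                (p (y ⟨((r : Fin R) : ℕ) * m + z.2, mul_add_lt hRm r z.2⟩ ω)
                  / q (y ⟨((r : Fin R) : ℕ) * m + z.2, mul_add_lt hRm r z.2⟩ ω)))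
            / (m * (m - 1))})
    (hhi : ∀ ω, (R : ℝ) / 2 ≤ #{r ∈ (univ : Finset (Fin R)) |
        (∑ z ∈ (univ : Finset (Fin m)).offDiag,
            min (p (y ⟨((r : Fin R) : ℕ) * m + z.1, mul_add_lt hRm r z.1⟩ ω)
                  / q (y ⟨((r : Fin R) : ℕ) * m + z.1, mul_add_lt hRm r z.1⟩ ω))
                (p (y ⟨((r : Fin R) : ℕ) * m + z.2, mul_add_lt hRm r z.2⟩ ω)
                  / q (y ⟨((r : Fin R) : ℕ) * m + z.2, mul_add_lt hRm r z.2⟩ ω)))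
            / (m * (m - 1)) ≤ med ω}) :
    P.real {ω | t ≤ |med ω - ∫ a, ∫ b, min (p a * q b) (p b * q a) ∂μ ∂μ|}
      ≤ exp (-(R / 8)) := by
  refine (measureReal_mono ?_).trans
    (acceptance_medianOfBlocks_confidence hym hind hp0 hpm hpi hp1 hq0 hqm hqi hlaw hm hRm ht hvt)
  intro ω hω
  simp only [Set.mem_setOf_eq] at hω ⊢
  by_contra hlt
  push Not at hlt
  have hR : (#(univ : Finset (Fin R)) : ℝ) = R := by rw [card_univ, Fintype.card_fin]
  have h := abs_median_sub_lt_of_card_lt (univ : Finset (Fin R)) _ (hR ▸ hlo ω) (hR ▸ hhi ω)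
    (hR ▸ hlt)
  linarith

/-- **THE CEILING-FREE CERTIFICATE FOR THE PRINTED MEDIAN (a-priori radius)**: for ANY selection
`med(ω)` of a sample median of the `R` printed block estimates and `t > 0` with `4/(m − 1) ≤ t²`:
`P(t ≤ |med − acc(p, q)|) ≤ exp(−R/8)` — nothing about the target or the model enters. [ours] -/
theorem acceptance_sampleMedian_confidence_simple {y : Fin n → Ω → X}
    (hym : ∀ j, Measurable (y j)) (hind : iIndepFun y P) {p q : X → ℝ} (hp0 : ∀ z, 0 ≤ p z)
    (hpm : Measurable p) (hpi : Integrable p μ) (hp1 : ∫ z, p z ∂μ = 1) (hq0 : ∀ z, 0 < q z)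
    (hqm : Measurable q) (hqi : Integrable q μ)
    (hlaw : ∀ j, Measure.map (y j) P = μ.withDensity fun z => ENNReal.ofReal (q z))
    (hm : 2 ≤ m) (hRm : R * m ≤ n) {t : ℝ} (ht : 0 < t) (hmt : 4 / (m - 1 : ℝ) ≤ t ^ 2)
    {med : Ω → ℝ}
    (hlo : ∀ ω, (R : ℝ) / 2 ≤ #{r ∈ (univ : Finset (Fin R)) | med ω ≤
        (∑ z ∈ (univ : Finset (Fin m)).offDiag,
            min (p (y ⟨((r : Fin R) : ℕ) * m + z.1, mul_add_lt hRm r z.1⟩ ω)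
                  / q (y ⟨((r : Fin R) : ℕ) * m + z.1, mul_add_lt hRm r z.1⟩ ω))
                (p (y ⟨((r : Fin R) : ℕ) * m + z.2, mul_add_lt hRm r z.2⟩ ω)
                  / q (y ⟨((r : Fin R) : ℕ) * m + z.2, mul_add_lt hRm r z.2⟩ ω)))
            / (m * (m - 1))})
    (hhi : ∀ ω, (R : ℝ) / 2 ≤ #{r ∈ (univ : Finset (Fin R)) |
        (∑ z ∈ (univ : Finset (Fin m)).offDiag,
            min (p (y ⟨((r : Fin R) : ℕ) * m + z.1, mul_add_lt hRm r z.1⟩ ω)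
                  / q (y ⟨((r : Fin R) : ℕ) * m + z.1, mul_add_lt hRm r z.1⟩ ω))
                (p (y ⟨((r : Fin R) : ℕ) * m + z.2, mul_add_lt hRm r z.2⟩ ω)
                  / q (y ⟨((r : Fin R) : ℕ) * m + z.2, mul_add_lt hRm r z.2⟩ ω)))
            / (m * (m - 1)) ≤ med ω}) :
    P.real {ω | t ≤ |med ω - ∫ a, ∫ b, min (p a * q b) (p b * q a) ∂μ ∂μ|}
      ≤ exp (-(R / 8)) := by
  refine acceptance_sampleMedian_confidence hym hind hp0 hpm hpi hp1 hq0 hqm hqi hlaw hm hRm ht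
    ((mul_le_mul_of_nonneg_left (acceptanceEnvelope_le_inv hm) (by norm_num)).trans ?_) hlo hhi
  rw [mul_one_div]
  exact hmt

end Median

end Summit.Ventures.LatticeQCDFlow.Scoring.AllPairsMedian

end
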